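import Summits.BirchSwinnertonDyer.BirchSwinnertonDyer.Theorems.BiquadraticEisensteinDescentHeegnerTwistCouplingInSupplySymbolicMonskyPatternFreeSymb
import Summits.BirchSwinnertonDyer.BirchSwinnertonDyer.Theorems.BiquadraticEisensteinDescentHeegnerTwistCouplingInSupplySignTableDoor
import HarnessLib

set_option linter.dupNamespace false -- `Summit.BirchSwinnertonDyer.BirchSwinnertonDyer.Theorems.…` (summit = sub)
set_option autoImplicit false

/-!
# Crux `HeegnerTwistCouplingInSupply` (stmt-BirchSwinnertonDyer-21381) — THE DOOR AT GENERAL `k` FOR PATTERN-FREE RECIPES: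
# a realised pattern-free recipe on the base `E_{P₀⋯P_k}` / `E_{2P₀⋯P_k}` gives the crux conclusion, modulo Burungale–Tian only

Route `BiquadraticEisensteinDescent` (cell `pub/bsd-wall`, width seat `bsd-wall-cm-bed-w3` g20; `--supports` 21381, helper). Third file of
the pattern-free layer (`…SymbolicMonskyPatternFreeDefs` reviewed defs; `…SymbolicMonskyPatternFree` criterion soundness). This is w3 g18's
door `…SignTableDoor` (k = 1, winning recipe with its mutual symbols realised) rewritten at GENERAL `k` for PATTERN-FREE recipes: the
realisation predicate `RealisesK` asks NOTHING of the mutual symbols `(q_j/q_i)`.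

* §6 `RealisesK.toMatches` — the prime tuple `Fin.append P q` realises `dataK base aux pat` for any pattern `pat` recording the actual mutual
  symbols; `prod_mod_eight`, `jacobiSym_neg_prod` (every base prime splits in `K′ = ℚ(√−q₁⋯q_t)`) from `heegnerK`;
  `exists_heegnerField` (imaginary quadratic, `|d| > 4`, Heegner for levels supported on `2` and the base, `P₀ ∤ h(K′)` from
  `√(∏q) log(∏q) < π P₀`, Oesterlé); `det_odd/even` — `det M = 1` for the ACTUAL primes from `pfRecipeOdd/Even` via the criterion;
  `L_ne_zero_odd/even` — `L(E_{n₀}^{(−∏q)}, 1) ≠ 0` (Monsky's theorem, tree; Burungale–Tian rank-zero `2`-converse, named fact);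
  ★ `cruxOn_odd_of_BT` / `cruxOn_even_of_BT` — the conclusion of `HeegnerTwistCouplingInSupply` for `(W, P₀)`, `W = E_{P₀⋯P_k}` / `E_{2P₀⋯P_k}`.

HONEST LIMITS: door lemmas (the SUPPLY of slot primes for almost all `P₀` is the Linnik census `…LinnikCensusSlot`, to be assembled per
base at general `k` exactly as `…LinnikCensusKOne` does at `k = 1`); congruent-number (`j = 1728`, full `2`-torsion) families only; modulo
Burungale–Tian; the crux as stated (C⁺), its stubs and BSD untouched; nothing closed. THEOREMS ONLY (no `def`).
-/

namespace Summit.BirchSwinnertonDyer.BirchSwinnertonDyer.Theorems.SymbolicMonsky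

/-! ## §6 The sign-table game at general `k`: realisation, Heegner field, and THE DOOR (pattern-free) -/

section DoorK

open Matrix Literature.NumberTheory.EllipticCurves Literature.NumberTheory.EllipticCurves.HeathBrown1994
  Literature.NumberTheory.EllipticCurves.HeathBrown1994.Families
open Literature.NumberTheory.EllipticCurves.Rank1Residual
open Literature.NumberTheory.EllipticCurves.CongruentNumberMonskySelmer
  (card_selmerGroup_two_eq_four_of_det_even' card_selmerGroup_two_eq_four_of_det_odd')
open Summit.BirchSwinnertonDyer.BirchSwinnertonDyer.Theorems.BiquadraticEisensteinDescentHeegnerTwistCouplingInSupplyCornersThreeFacts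
  (dvd_two_mul_of_prime_dvd_conductorNorm)
open Summit.BirchSwinnertonDyer.BirchSwinnertonDyer.Theorems.BiquadraticEisensteinDescentHeegnerTwistCouplingInSupplySizeIndivisibleSharp
  (not_dvd_classNumber_of_sqrt_mul_log_lt_pi_mul)

variable {k : ℕ} {base : SymbData (k + 1)} {aux : List AuxCell} {P : Fin (k + 1) → ℕ} {q : Fin aux.length → ℕ}

/-- `sgn` is multiplicative for XOR (private copy; the original in `…SymbolicMonskyRealise` is private). -/
private theorem sgn_xor' (a b : Bool) : sgn (xor a b) = sgn a * sgn b := by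
  cases a <;> cases b <;> decide

/-- The auxiliary cell list is the list of `aux.getD i (0,0)`, `i < t`. -/
theorem aux_eq_map (aux : List AuxCell) :
    aux = (List.finRange aux.length).map (fun i : Fin aux.length => aux.getD i.val (0, 0)) := by
  apply List.ext_getElem
  · simp
  · intro n h1 h2
    simp [List.getD_eq_getElem?_getD]

/-- `∏ᵢ f (aux i)` over `Fin t` is the list product over the cells. -/
theorem prod_aux_eq (aux : List AuxCell) (f : AuxCell → ℕ) :
    ∏ i : Fin aux.length, f (aux.getD i.val (0, 0)) = (aux.map f).prod := by
  rw [← List.prod_ofFn, List.ofFn_eq_map]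
  conv_rhs => rw [aux_eq_map aux, List.map_map]
  rfl

/-- XOR over `Fin t` of a function of the cells = XOR over the cell list. -/
theorem xorFold_aux_eq (aux : List AuxCell) (f : AuxCell → Bool) :
    xorFold (List.finRange aux.length) (fun i : Fin aux.length => f (aux.getD i.val (0, 0))) = xorFold aux f := by
  conv_rhs => rw [aux_eq_map aux, xorFold_map]
  rfl

/-- Unpacking of the general-`k` Heegner check. -/
theorem heegnerK_spec (h : heegnerK base aux = true) :
    0 < aux.length ∧ (aux.map fun c => clsVal c.1).prod % 8 = 7 ∧
      ∀ b : Fin (k + 1), xorFold aux (fun c => c.2.testBit b.val) = negNegOne (base.cls b) := by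
  simp only [heegnerK, Bool.and_eq_true, decide_eq_true_eq, beq_iff_eq, List.all_eq_true, List.mem_finRange,
    true_implies] at h
  exact ⟨h.1.1, h.1.2, h.2⟩

namespace RealisesK

/-- Values of `dataK` on base indices (classes). -/
theorem dataK_cls_castAdd (base : SymbData (k + 1)) (aux : List AuxCell) (pat : ℕ → ℕ → Bool) (b : Fin (k + 1)) :
    (dataK base aux pat).cls (Fin.castAdd aux.length b) = base.cls b := by
  simp only [dataK, Fin.val_castAdd]
  rw [dif_pos b.isLt]

/-- Values of `dataK` on auxiliary indices (classes). -/
theorem dataK_cls_natAdd (base : SymbData (k + 1)) (aux : List AuxCell) (pat : ℕ → ℕ → Bool) (j : Fin aux.length) :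
    (dataK base aux pat).cls (Fin.natAdd (k + 1) j) = (aux.getD j.val (0, 0)).1 := by
  simp only [dataK, Fin.val_natAdd]
  rw [dif_neg (by omega), Nat.add_sub_cancel_left]

/-- Values of `dataK.up` on base × base. -/
theorem dataK_up_castAdd_castAdd (base : SymbData (k + 1)) (aux : List AuxCell) (pat : ℕ → ℕ → Bool) (b b' : Fin (k + 1)) :
    (dataK base aux pat).up (Fin.castAdd aux.length b) (Fin.castAdd aux.length b') = base.up b b' := by
  simp only [dataK, Fin.val_castAdd]
  rw [dif_pos b'.isLt, dif_pos b.isLt]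

/-- Values of `dataK.up` on base × aux. -/
theorem dataK_up_castAdd_natAdd (base : SymbData (k + 1)) (aux : List AuxCell) (pat : ℕ → ℕ → Bool) (b : Fin (k + 1))
    (j : Fin aux.length) :
    (dataK base aux pat).up (Fin.castAdd aux.length b) (Fin.natAdd (k + 1) j) = (aux.getD j.val (0, 0)).2.testBit b.val := by
  simp only [dataK, Fin.val_castAdd, Fin.val_natAdd]
  rw [dif_neg (by omega), if_pos b.isLt, Nat.add_sub_cancel_left]

/-- Values of `dataK.up` on aux × aux. -/
theorem dataK_up_natAdd_natAdd (base : SymbData (k + 1)) (aux : List AuxCell) (pat : ℕ → ℕ → Bool) (i j : Fin aux.length) :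
    (dataK base aux pat).up (Fin.natAdd (k + 1) i) (Fin.natAdd (k + 1) j) = pat i.val j.val := by
  simp only [dataK, Fin.val_natAdd]
  rw [dif_neg (by omega), if_neg (by omega), Nat.add_sub_cancel_left, Nat.add_sub_cancel_left]

/-- **A realised general-`k` recipe realises its symbol data**, for ANY mutual pattern `pat` recording the actual symbols
`(q_j/q_i)`, `i < j`. -/
theorem toMatches (h : RealisesK base aux P q) (pat : ℕ → ℕ → Bool)
    (hpat : ∀ i j : Fin aux.length, i < j → (jacobiSym (q j : ℤ) (q i) = -1 ↔ pat i.val j.val = true)) :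
    Matches (Fin.append P q) (dataK base aux pat) where
  prime i := by
    refine Fin.addCases (fun b => ?_) (fun j => ?_) i
    · rw [Fin.append_left]; exact h.base_matches.prime b
    · rw [Fin.append_right]; exact h.qprime j
  injective := by
    intro x y hxy
    revert hxy
    refine Fin.addCases (fun b => ?_) (fun j => ?_) x <;> refine Fin.addCases (fun b' => ?_) (fun j' => ?_) y
    · rw [Fin.append_left, Fin.append_left]
      intro hh; rw [h.base_matches.injective hh]
    · rw [Fin.append_left, Fin.append_right]
      intro hh; exact absurd hh.symm (h.q_ne j' b)
    · rw [Fin.append_right, Fin.append_left]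
      intro hh; exact absurd hh (h.q_ne j b')
    · rw [Fin.append_right, Fin.append_right]
      intro hh; rw [h.qinj hh]
  mod_eight i := by
    refine Fin.addCases (fun b => ?_) (fun j => ?_) i
    · rw [Fin.append_left, dataK_cls_castAdd]; exact h.base_matches.mod_eight b
    · rw [Fin.append_right, dataK_cls_natAdd]; exact h.q_mod j
  up_iff i j hij := by
    revert hij
    refine Fin.addCases (fun b => ?_) (fun i' => ?_) i <;> refine Fin.addCases (fun b' => ?_) (fun j' => ?_) j
    · intro hij
      rw [Fin.append_left, Fin.append_left, dataK_up_castAdd_castAdd]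
      exact h.base_matches.up_iff b b' (Fin.lt_def.mpr (Fin.lt_def.mp hij))
    · intro _
      rw [Fin.append_left, Fin.append_right, dataK_up_castAdd_natAdd]
      exact h.symb_iff j' b
    · intro hij
      exfalso
      have h1 : (k + 1) + i'.val < b'.val := Fin.lt_def.mp hij
      have h2 := b'.isLt
      omega
    · intro hij
      rw [Fin.append_right, Fin.append_right, dataK_up_natAdd_natAdd]
      have h1 : (k + 1) + i'.val < (k + 1) + j'.val := Fin.lt_def.mp hij
      exact hpat i' j' (Fin.lt_def.mpr (by omega))

/-- The full prime tuple is odd. -/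
theorem odd_append (h : RealisesK base aux P q) : ∀ i, Odd (Fin.append P q i) := fun i =>
  Nat.odd_iff.mpr ((h.toMatches (fun i j => if hh : i < aux.length ∧ j < aux.length then
      decide (jacobiSym (q ⟨j, hh.2⟩ : ℤ) (q ⟨i, hh.1⟩) = -1) else false) (fun i j _ => by simp [i.isLt, j.isLt])).mod_two i)

/-- The product of the full prime tuple. -/
theorem prod_append (P : Fin (k + 1) → ℕ) (q : Fin aux.length → ℕ) :
    ∏ i, Fin.append P q i = (∏ b, P b) * ∏ j, q j := by
  rw [Fin.prod_univ_add]
  simp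

/-- `(∏ P) · (∏ q)` is squarefree. -/
theorem squarefree_prod (h : RealisesK base aux P q) : Squarefree ((∏ b, P b) * ∏ j, q j) := by
  rw [← prod_append]
  have hM := h.toMatches (fun i j => if hh : i < aux.length ∧ j < aux.length then
      decide (jacobiSym (q ⟨j, hh.2⟩ : ℤ) (q ⟨i, hh.1⟩) = -1) else false) (fun i j _ => by simp [i.isLt, j.isLt])
  exact squarefree_prod_of_injective _ hM.prime hM.injective

/-- `∏ q` is squarefree. -/
theorem squarefree_prod_q (h : RealisesK base aux P q) : Squarefree (∏ j, q j) :=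
  squarefree_prod_of_injective _ h.qprime h.qinj

/-- The auxiliary product is `≡ 7 (mod 8)`. -/
theorem prod_mod_eight (h : RealisesK base aux P q) (hh : heegnerK base aux = true) : (∏ j, q j) % 8 = 7 := by
  obtain ⟨-, hprod, -⟩ := heegnerK_spec hh
  rw [Finset.prod_nat_mod, Finset.prod_congr rfl (fun j _ => h.q_mod j), prod_aux_eq aux (fun c => clsVal c.1)]
  exact hprod

/-- `(−q₁⋯q_t / P_b) = +1` for every base prime: `P_b` splits in `ℚ(√−q₁⋯q_t)`. -/
theorem jacobiSym_neg_prod (h : RealisesK base aux P q) (hh : heegnerK base aux = true) (b : Fin (k + 1)) :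
    jacobiSym (-((∏ j, q j : ℕ) : ℤ)) (P b) = 1 := by
  obtain ⟨-, -, hx⟩ := heegnerK_spec hh
  have hq : ∀ j, jacobiSym (q j : ℤ) (P b) = sgn ((aux.getD j.val (0, 0)).2.testBit b.val) := fun j =>
    jacobiSym_eq_sgn_of_iff
      (jacobiSym.eq_one_or_neg_one (int_gcd_eq_one_of_primes (h.qprime j) (h.base_matches.prime b) (h.q_ne j b)))
      (h.symb_iff j b)
  rw [neg_eq_neg_one_mul, jacobiSym.mul_left, Recipe.RealisesK1.jacobiSym_neg_one_eq_sgn (h.base_matches.mod_eight b),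
    jacobiSym_finset_prod_left, Finset.prod_congr rfl (fun j _ => hq j),
    prod_sgn_eq_sgn_xorFold (fun j : Fin aux.length => (aux.getD j.val (0, 0)).2.testBit b.val),
    xorFold_aux_eq aux (fun c => c.2.testBit b.val), ← sgn_xor', hx b, Bool.xor_self]
  rfl

/-- **The Heegner field** `K′ = ℚ(√−q₁⋯q_t)` of a realised general-`k` recipe passing the Heegner check: imaginary quadratic,
`d_{K′} = −q₁⋯q_t`, `|d_{K′}| > 4`, Heegner for every level supported on `2` and the base primes, and — given the size bound
`√(q₁⋯q_t)·log(q₁⋯q_t) < π P₀` (Oesterlé) — `P₀ ∤ h(K′)`. [cite: Oesterle1988Gauss, II §3 Proposition p. 57 (27)] -/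
theorem exists_heegnerField (h : RealisesK base aux P q) (hh : heegnerK base aux = true)
    {N : ℕ} (hN : ∀ ℓ : ℕ, ℓ.Prime → ℓ ∣ N → ℓ = 2 ∨ ∃ b, ℓ = P b)
    (hsize : Real.sqrt ((∏ j, q j : ℕ) : ℝ) * Real.log ((∏ j, q j : ℕ) : ℝ) < Real.pi * P 0) :
    ∃ (K : Type) (_ : Field K) (_ : NumberField K),
      IsImaginaryQuadratic K ∧ NumberField.discr K = -((∏ j, q j : ℕ) : ℤ) ∧ 4 < (NumberField.discr K).natAbs ∧
      SatisfiesHeegnerHypothesis N K ∧ ¬ P 0 ∣ NumberField.classNumber K := by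
  have h8 := h.prod_mod_eight hh
  set D : ℕ := ∏ j, q j with hD
  have hD7 : 7 ≤ D := by omega
  haveI : Fact ((-(D : ℤ)) < 0) := ⟨by omega⟩
  have hsf : Squarefree (-(D : ℤ)).natAbs := by
    rw [Int.natAbs_neg, Int.natAbs_natCast]; exact h.squarefree_prod_q
  obtain ⟨hK, hdK⟩ := isImaginaryQuadratic_and_discr_sqrtField_of_squarefree_natAbs (-(D : ℤ)) (by omega) hsf
  refine ⟨sqrtField (-(D : ℤ)), inferInstance, inferInstance, hK, hdK, ?_, ?_, ?_⟩
  · rw [hdK, Int.natAbs_neg, Int.natAbs_natCast]; omega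
  · refine satisfiesHeegnerHypothesis_sqrtField_of_squarefree_natAbs _ (by omega) hsf fun ℓ hℓ hℓN => ?_
    rcases hN ℓ hℓ hℓN with h2 | ⟨b, rfl⟩
    · exact Or.inl h2
    · exact Or.inr (h.jacobiSym_neg_prod hh b)
  · refine not_dvd_classNumber_of_sqrt_mul_log_lt_pi_mul hK ?_ ?_
    · rw [hdK, Int.natAbs_neg, Int.natAbs_natCast]; omega
    · rw [hdK, Int.natAbs_neg, Int.natAbs_natCast]; exact hsize

/-- **`det M_odd = 1` for the actual primes of a realised PATTERN-FREE recipe** (odd base): the realised data agree with the reference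
data off the auxiliary block, so the criterion applies — NO condition on the mutual symbols `(q_j/q_i)`. -/
theorem det_odd (h : RealisesK base aux P q) (hpf : pfRecipeOdd base aux = true) :
    (monskyMatrixOdd (Fin.append P q)).det = 1 := by
  have hM := h.toMatches (fun i j => if hh : i < aux.length ∧ j < aux.length then
      decide (jacobiSym (q ⟨j, hh.2⟩ : ℤ) (q ⟨i, hh.1⟩) = -1) else false) (fun i j _ => by simp [i.isLt, j.isLt])
  rw [hM.monskyMatrixOdd_eq]
  exact (det_dataK_odd_of_pfRecipeOdd base aux hpf _).2

/-- **`det M_even = 1` for the actual primes of a realised PATTERN-FREE recipe** (even base). -/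
theorem det_even (h : RealisesK base aux P q) (hpf : pfRecipeEven base aux = true) :
    (monskyMatrixEven (Fin.append P q)).det = 1 := by
  have hM := h.toMatches (fun i j => if hh : i < aux.length ∧ j < aux.length then
      decide (jacobiSym (q ⟨j, hh.2⟩ : ℤ) (q ⟨i, hh.1⟩) = -1) else false) (fun i j _ => by simp [i.isLt, j.isLt])
  rw [hM.monskyMatrixEven_eq]
  exact (det_dataK_even_of_pfRecipeEven base aux hpf _).2

/-- **`L(E_{n₀}^{(−q₁⋯q_t)}, 1) ≠ 0` modulo Burungale–Tian**, `n₀ = P₀⋯P_k`, for a realised pattern-free recipe (odd base):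
`E_{n₀}^{(d)} = E_{n₀|d|}`, `det M_odd = 1` (criterion), `#Sel₂ = 4` (Monsky, tree theorem), rank-zero `2`-converse for CM curves.
[cite: BurungaleTian2026, Thm. 1.1] [cite: HeathBrown1994SelmerCongruentII, Appendix (Monsky), typescript p. 39 L10–L33] -/
theorem L_ne_zero_odd (hBT : burungaleTian_analyticRank_eq_zero_of_selmerCorank_eq_zero_of_hasCM)
    (h : RealisesK base aux P q) (hpf : pfRecipeOdd base aux = true) :
    ((congruentNumberCurve (∏ b, P b)).quadraticTwist ((-((∏ j, q j : ℕ) : ℤ) : ℤ) : ℚ)).entireLFunction 1 ≠ 0 := by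
  rw [quadraticTwist_congruentNumberCurve, Int.natAbs_neg, Int.natAbs_natCast]
  have hsq := h.squarefree_prod
  haveI := isElliptic_congruentNumberCurve hsq.ne_zero
  have hM := h.toMatches (fun i j => if hh : i < aux.length ∧ j < aux.length then
      decide (jacobiSym (q ⟨j, hh.2⟩ : ℤ) (q ⟨i, hh.1⟩) = -1) else false) (fun i j _ => by simp [i.isLt, j.isLt])
  have hsel : Nat.card ((congruentNumberCurve ((∏ b, P b) * ∏ j, q j)).selmerGroup 2) = 4 :=
    card_selmerGroup_two_eq_four_of_det_odd' _ (prod_append P q) hM.prime h.odd_append hM.injective (h.det_odd hpf)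
  exact (L_one_ne_zero_congruentNumberCurve_of_card_selmerGroup_two hBT hsq hsel).2

/-- **`L(E_{2n₀}^{(−q₁⋯q_t)}, 1) ≠ 0` modulo Burungale–Tian** for a realised pattern-free recipe (even base).
[cite: BurungaleTian2026, Thm. 1.1] [cite: HeathBrown1994SelmerCongruentII, Appendix (Monsky), typescript p. 41 L20–L36] -/
theorem L_ne_zero_even (hBT : burungaleTian_analyticRank_eq_zero_of_selmerCorank_eq_zero_of_hasCM)
    (h : RealisesK base aux P q) (hpf : pfRecipeEven base aux = true) :
    ((congruentNumberCurve (2 * ∏ b, P b)).quadraticTwist ((-((∏ j, q j : ℕ) : ℤ) : ℤ) : ℚ)).entireLFunction 1 ≠ 0 := by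
  rw [quadraticTwist_congruentNumberCurve, Int.natAbs_neg, Int.natAbs_natCast, mul_assoc]
  have hM := h.toMatches (fun i j => if hh : i < aux.length ∧ j < aux.length then
      decide (jacobiSym (q ⟨j, hh.2⟩ : ℤ) (q ⟨i, hh.1⟩) = -1) else false) (fun i j _ => by simp [i.isLt, j.isLt])
  have hsq : Squarefree (2 * ((∏ b, P b) * ∏ j, q j)) := by
    rw [← prod_append]
    exact squarefree_two_mul_prod_of_injective _ hM.prime h.odd_append hM.injective
  haveI := isElliptic_congruentNumberCurve hsq.ne_zero
  have hsel : Nat.card ((congruentNumberCurve (2 * ((∏ b, P b) * ∏ j, q j))).selmerGroup 2) = 4 :=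
    card_selmerGroup_two_eq_four_of_det_even' _ (by rw [prod_append]) hM.prime h.odd_append hM.injective (h.det_even hpf)
  exact (L_one_ne_zero_congruentNumberCurve_of_card_selmerGroup_two hBT hsq hsel).2

/-- ★ **THE DOOR at general `k`, odd base `W = E_{P₀ P₁ ⋯ P_k}`**: a PATTERN-FREE recipe (`pfRecipeOdd`, one `decide`) realised by
primes `q₁ … q_t` — distinct, in the cells, with the prescribed symbols against the base, NOTHING asked of `(q_j/q_i)` — with
`√(q₁⋯q_t)·log(q₁⋯q_t) < π P₀` gives the conclusion of `HeegnerTwistCouplingInSupply` for `(W, P₀)`, modulo Burungale–Tian ONLY: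
`K′ = ℚ(√−q₁⋯q_t)` imaginary quadratic, `4 < |d_{K′}|`, Heegner for `N(W)` (support `⊆ {2, P₀, …, P_k}`, modularity-free),
`L(W^{(d_{K′})}, 1) ≠ 0` and `P₀ ∤ h(K′)`. [cite: BurungaleTian2026, Thm. 1.1] [cite: Oesterle1988Gauss, II §3 Proposition p. 57 (27)] -/
theorem cruxOn_odd_of_BT (hBT : burungaleTian_analyticRank_eq_zero_of_selmerCorank_eq_zero_of_hasCM)
    (hpf : pfRecipeOdd base aux = true) (h : RealisesK base aux P q) {n : ℕ} (hn : ∏ b, P b = n)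
    [(congruentNumberCurve n).IsElliptic]
    (hsize : Real.sqrt ((∏ j, q j : ℕ) : ℝ) * Real.log ((∏ j, q j : ℕ) : ℝ) < Real.pi * P 0) :
    ∃ (K : Type) (_ : Field K) (_ : NumberField K),
      IsImaginaryQuadratic K ∧ 4 < (NumberField.discr K).natAbs ∧
      SatisfiesHeegnerHypothesis ((congruentNumberCurve n).conductorNorm ℤ) K ∧
      ((congruentNumberCurve n).quadraticTwist (NumberField.discr K : ℚ)).entireLFunction 1 ≠ 0 ∧
      ¬ P 0 ∣ NumberField.classNumber K := by
  subst hn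
  have hh : heegnerK base aux = true := by
    simp only [pfRecipeOdd, Bool.and_eq_true] at hpf; exact hpf.1
  have hN : ∀ ℓ : ℕ, ℓ.Prime → ℓ ∣ (congruentNumberCurve (∏ b, P b)).conductorNorm ℤ → ℓ = 2 ∨ ∃ b, ℓ = P b := by
    intro ℓ hℓ hℓN
    have h2 : ℓ ∣ 2 * ∏ b, P b := dvd_two_mul_of_prime_dvd_conductorNorm hℓ hℓN
    rcases (Nat.Prime.dvd_mul hℓ).mp h2 with h2 | hP
    · exact Or.inl ((Nat.prime_dvd_prime_iff_eq hℓ Nat.prime_two).mp h2)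
    · obtain ⟨b, -, hb⟩ := ((Nat.Prime.prime hℓ).dvd_finsetProd_iff _).mp hP
      exact Or.inr ⟨b, (Nat.prime_dvd_prime_iff_eq hℓ (h.base_matches.prime b)).mp hb⟩
  obtain ⟨K, iF, iN, hK, hdK, h4, hH, hcl⟩ := h.exists_heegnerField hh hN hsize
  refine ⟨K, iF, iN, hK, h4, hH, ?_, hcl⟩
  rw [hdK]
  exact h.L_ne_zero_odd hBT hpf

/-- ★ **THE DOOR at general `k`, even base `W = E_{2 P₀ P₁ ⋯ P_k}`** (same statement for the even base, `N(W)` supported on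
`{2, P₀, …, P_k}`). [cite: BurungaleTian2026, Thm. 1.1] [cite: Oesterle1988Gauss, II §3 Proposition p. 57 (27)] -/
theorem cruxOn_even_of_BT (hBT : burungaleTian_analyticRank_eq_zero_of_selmerCorank_eq_zero_of_hasCM)
    (hpf : pfRecipeEven base aux = true) (h : RealisesK base aux P q) {n : ℕ} (hn : ∏ b, P b = n)
    [(congruentNumberCurve (2 * n)).IsElliptic]
    (hsize : Real.sqrt ((∏ j, q j : ℕ) : ℝ) * Real.log ((∏ j, q j : ℕ) : ℝ) < Real.pi * P 0) :
    ∃ (K : Type) (_ : Field K) (_ : NumberField K),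
      IsImaginaryQuadratic K ∧ 4 < (NumberField.discr K).natAbs ∧
      SatisfiesHeegnerHypothesis ((congruentNumberCurve (2 * n)).conductorNorm ℤ) K ∧
      ((congruentNumberCurve (2 * n)).quadraticTwist (NumberField.discr K : ℚ)).entireLFunction 1 ≠ 0 ∧
      ¬ P 0 ∣ NumberField.classNumber K := by
  subst hn
  have hh : heegnerK base aux = true := by
    simp only [pfRecipeEven, Bool.and_eq_true] at hpf; exact hpf.1
  have hN : ∀ ℓ : ℕ, ℓ.Prime → ℓ ∣ (congruentNumberCurve (2 * ∏ b, P b)).conductorNorm ℤ → ℓ = 2 ∨ ∃ b, ℓ = P b := by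
    intro ℓ hℓ hℓN
    have h4 : ℓ ∣ 2 * (2 * ∏ b, P b) := dvd_two_mul_of_prime_dvd_conductorNorm hℓ hℓN
    rcases (Nat.Prime.dvd_mul hℓ).mp h4 with h2 | h2
    · exact Or.inl ((Nat.prime_dvd_prime_iff_eq hℓ Nat.prime_two).mp h2)
    · rcases (Nat.Prime.dvd_mul hℓ).mp h2 with h2 | hP
      · exact Or.inl ((Nat.prime_dvd_prime_iff_eq hℓ Nat.prime_two).mp h2)
      · obtain ⟨b, -, hb⟩ := ((Nat.Prime.prime hℓ).dvd_finsetProd_iff _).mp hP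
        exact Or.inr ⟨b, (Nat.prime_dvd_prime_iff_eq hℓ (h.base_matches.prime b)).mp hb⟩
  obtain ⟨K, iF, iN, hK, hdK, h4, hH, hcl⟩ := h.exists_heegnerField hh hN hsize
  refine ⟨K, iF, iN, hK, h4, hH, ?_, hcl⟩
  rw [hdK]
  exact h.L_ne_zero_even hBT hpf

end RealisesK

end DoorK

end Summit.BirchSwinnertonDyer.BirchSwinnertonDyer.Theorems.SymbolicMonsky
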